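import Literature.MathematicalPhysics.QuantumLattice.FermionEntropyChainRule
import Literature.MathematicalPhysics.QuantumLattice.FermionConditionalFreeEnergyCertificate
import Literature.MathematicalPhysics.QuantumLattice.InfVolFermionState
import HarnessLib

/-!
# The Markov (conditional-entropy) upper bound on the pressure of a translation-invariant
# lattice-fermion Hamiltonian on the torus, and its dual certificate

Topic `MathematicalPhysics/QuantumLattice`, namespace `Literature.MathematicalPhysics.QuantumLattice`.

Let `K` be an even, translation-invariant Hermitian matrix on the Fock space of the fermionic torus
`(ℤ/Lℤ)^d` (two spin states per site; e.g. `H_L − μ N_L` for a Hubbard-type Hamiltonian), `β` real,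
`ρ_β = e^{−βK}/Z` its Gibbs density, and `Λ ⊆ [0, ℓ)^d` a WINDOW with lexicographically largest
site `a` ("shield" `B = Λ ∖ a`), pulled back into the torus by `x ↦ x mod L` (`L ≥ ℓ`). Writing
`ρ_Λ, ρ_B` for the restrictions of `ρ_β` to the local CAR algebras `𝔄_Λ, 𝔄_B`
(`fermionPartialTrace`), this file proves the finite-volume inequalities

* `torus_vonNeumannEntropy_le_window` — for every even translation-invariant density matrix `ρ` on
  the torus: `S(ρ) ≤ N · (S(ρ_Λ) − S(ρ_B)) + (L^d − N) · log 4`, `N = (L + 1 − ℓ)^d` (pull the torus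
  back to the box `[0,L)^d ⊆ ℤ^d`, a bijection of sites; the window entropies of the translates
  `Λ + v ⊆ [0,L)^d`, `v ∈ [0, L−ℓ]^d`, all equal `S(ρ_Λ)` by translation invariance; then the
  chain rule + strong subadditivity of `FermionEntropyChainRule.lean`);
* `torus_log_partitionFn_le_window` — the **Markov bound on the pressure**:
  `log Z_β(K) ≤ N · (S(ρ_Λ) − S(ρ_B)) + (L^d − N) · log 4 − β Re tr(ρ_β K)`
  (Gibbs variational identity `log Z = S(ρ_β) − β⟨K⟩_β`, tree `vonNeumannEntropy_gibbsDensity`);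
* `torus_log_partitionFn_le_of_certificate` — with a local energy representative `h ∈ 𝔄_Λ`
  (`tr(ρ_β K) = L^d · Re tr(ρ_Λ h)`, hypothesis `hKh`) and a dual certificate `(L_B, c)` for
  `H = β h` (`FermionConditionalFreeEnergyCertificate.lean`):
  `log Z_β(K) ≤ L^d · c + (L^d − N) · (log 4 − c − β e)`, `e = Re tr(ρ_Λ h)` the energy per site —
  i.e. `p_L(β) ≤ c + O(ℓ/L)`: the certified UPPER bound on the pressure of the free-energy route.

This is the Markov-entropy-decomposition bound of [cite: PoulinHastings2011, eqs. (3)–(8)] (there for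
quantum spin systems, as a LOWER bound on the free energy), for lattice fermions (the fermionic input
being Araki–Moriya's SSA, `fermion_strongSubadditivity`), in finite volume with periodic boundary
conditions and an explicit boundary term. Everything is PROVED; no definition of mathematical content
(`torusBoxEmb` is bookkeeping), no named fact.
-/

noncomputable section

namespace Literature.MathematicalPhysics.QuantumLattice

open Matrix Finset HubbardWave0 Literature.Probability.LatticeModels
open scoped ComplexOrder
open Literature.InformationTheory.Entropy (vonNeumannEntropy)

variable {d : ℕ}

/-! ### §1. Pulling the torus back to the box `[0, L)^d` -/

/-- A region inside `[0, ℓ)^d` fits into every torus of side `L ≥ ℓ` (`x ↦ x mod L` is injective on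
it). [cite: FriedliVelenik2017, §3.1] -/
theorem injOn_proj_of_subset_halfOpenBox' {Λ : Finset (Site d)} {ℓ : ℕ} (hΛ : Λ ⊆ halfOpenBox d ℓ)
    {L : ℕ} (hL : ℓ ≤ L) : Set.InjOn (Torus.proj (d := d) L) ↑Λ := by
  intro x hx y hy hxy
  refine Torus.proj_injective_of_abs_sub_lt (fun j => ?_) hxy
  have hx' := (mem_halfOpenBox.1 (hΛ (Finset.mem_coe.1 hx))) j
  have hy' := (mem_halfOpenBox.1 (hΛ (Finset.mem_coe.1 hy))) j
  rw [abs_sub_lt_iff]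
  constructor <;> omega

variable (L : ℕ) [NeZero L]

/-- (Local.) At the concrete torus types two `DecidableEq` instances coexist (the structural one through
`Lex`/`Prod` and the one through the linear order, which the generic Jordan–Wigner lemmas carry); as in
`HubbardAndersonClusterBound.lean` we short-circuit to the latter. [folklore] -/
local instance (priority := high) instDecidableEqOrbFermionTorusMarkov : DecidableEq (Orb (FermionTorus d L)) :=
  LinearOrder.toDecidableEq

/-- The pull-back of the whole box `[0,L)^d` into the torus of side `L` (a bijection of sites).
[cite: FriedliVelenik2017, §3.1] -/
def torusBoxEmb : PolySite (halfOpenBox d L) ↪ FermionTorus d L :=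
  PolySite.toTorusEmb L (injOn_proj_of_subset_halfOpenBox' (subset_refl _) le_rfl)

/-- Every torus site is hit by the box: `torusBoxEmb` is onto. [cite: FriedliVelenik2017, §3.1] -/
theorem range_torusBoxEmb : Set.range (torusBoxEmb (d := d) L) = Set.univ := by
  refine Set.eq_univ_of_forall fun z => ?_
  set x : Site d := fun i => ((FermionTorus.toTorusSite z i).val : ℤ) with hx
  have hxmem : x ∈ halfOpenBox d L := by
    rw [mem_halfOpenBox]
    intro i
    refine ⟨by simp only [hx]; exact Int.natCast_nonneg _, ?_⟩
    have := ZMod.val_lt (FermionTorus.toTorusSite z i)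
    simp only [hx]
    exact_mod_cast this
  refine ⟨PolySite.pt x hxmem, ?_⟩
  rw [torusBoxEmb, PolySite.toTorusEmb_apply, PolySite.ofLex_coe_pt]
  have hproj : Torus.proj L x = FermionTorus.toTorusSite z := by
    funext i
    simp [Torus.proj, hx]
  rw [hproj, FermionTorus.ofTorusSite_toTorusSite]

/-- The entropy of a torus state equals the entropy of its pull-back to the box.
[cite: ArakiMoriya2003, §3.1] -/
theorem vonNeumannEntropy_fermionPartialTrace_torusBoxEmb
    {ρ : Matrix (Finset (Orb (FermionTorus d L))) (Finset (Orb (FermionTorus d L))) ℂ} (hρ : ρ.IsHermitian) :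
    vonNeumannEntropy (fermionPartialTrace (torusBoxEmb L) ρ) = vonNeumannEntropy ρ := by
  have hr : Set.range (torusBoxEmb (d := d) L) = Set.range (Function.Embedding.refl (FermionTorus d L)) := by
    rw [range_torusBoxEmb]
    ext z
    simp
  rw [vonNeumannEntropy_fermionPartialTrace_eq_of_range_eq (torusBoxEmb L) (Function.Embedding.refl _) hr hρ,
    fermionPartialTrace_refl]

/-- A window inside the box, pulled back through the box, is the window pulled back directly.
[folklore] -/
private theorem incl_trans_torusBoxEmb {Λ : Finset (Site d)} (hΛ : Λ ⊆ halfOpenBox d L) :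
    (PolySite.incl hΛ).trans (torusBoxEmb L) =
      PolySite.toTorusEmb L (injOn_proj_of_subset_halfOpenBox' hΛ le_rfl) :=
  DFunLike.ext _ _ fun _ => rfl

/-! ### §2. Translation invariance: all translates of a window carry the same entropy -/

omit [NeZero L] in
/-- `Torus.proj` is additive. [folklore] -/
private theorem proj_add (x y : Site d) : Torus.proj L (x + y) = Torus.proj L x + Torus.proj L y := by
  funext i
  simp [Torus.proj]

/-- Pulling the translated window back equals pulling back and translating on the torus.
[cite: ArakiMoriya2003, §4.1 Def. 4.3] -/
private theorem shiftEmb_trans_toTorusEmb {Λ : Finset (Site d)} (v : Site d)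
    (h : Set.InjOn (Torus.proj (d := d) L) ↑Λ) (h' : Set.InjOn (Torus.proj (d := d) L) ↑(shiftSet v Λ)) :
    (PolySite.shiftEmb v Λ).trans (PolySite.toTorusEmb L h') =
      (PolySite.toTorusEmb L h).trans
        (FermionTorus.ofTorusEquiv (Equiv.addRight (Torus.proj L v))).toEmbedding := by
  refine DFunLike.ext _ _ fun y => ?_
  rw [Function.Embedding.trans_apply, Function.Embedding.trans_apply, PolySite.toTorusEmb_apply,
    PolySite.toTorusEmb_apply, Equiv.coe_toEmbedding, FermionTorus.ofTorusEquiv_apply,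
    FermionTorus.toTorusSite_ofTorusSite, Equiv.coe_addRight, PolySite.ofLex_coe_shiftEmb, proj_add]

/-- `shiftEmb v Λ : Λ → Λ + v` is onto. [folklore] -/
private theorem range_shiftEmb (v : Site d) (Λ : Finset (Site d)) :
    Set.range (PolySite.shiftEmb v Λ) = Set.range (Function.Embedding.refl (PolySite (shiftSet v Λ))) := by
  ext y
  simp only [Set.mem_range, Function.Embedding.refl_apply, exists_eq, iff_true]
  have hy : ofLex y.1 - v ∈ Λ := mem_shiftSet.1 (PolySite.ofLex_mem y)
  refine ⟨PolySite.pt (ofLex y.1 - v) hy, Subtype.ext ?_⟩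
  rw [PolySite.coe_shiftEmb, PolySite.ofLex_coe_pt, sub_add_cancel, toLex_ofLex]

/-- **Translates of a window carry the same entropy** in a translation-invariant torus state:
`S(ρ_{Λ+v}) = S(ρ_Λ)`. [cite: ArakiMoriya2003, §4.1 Def. 4.5 (translation-invariant states)] -/
theorem vonNeumannEntropy_fermionPartialTrace_toTorusEmb_shiftSet
    {ρ : Matrix (Finset (Orb (FermionTorus d L))) (Finset (Orb (FermionTorus d L))) ℂ} (hρ : ρ.IsHermitian)
    (hTI : ∀ w : TorusSite d L, relabel (Orb.translate w) ρ = ρ) {Λ : Finset (Site d)} (v : Site d)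
    (h : Set.InjOn (Torus.proj (d := d) L) ↑Λ) (h' : Set.InjOn (Torus.proj (d := d) L) ↑(shiftSet v Λ)) :
    vonNeumannEntropy (fermionPartialTrace (PolySite.toTorusEmb L h') ρ) =
      vonNeumannEntropy (fermionPartialTrace (PolySite.toTorusEmb L h) ρ) := by
  have hH' : (fermionPartialTrace (PolySite.toTorusEmb L h') ρ).IsHermitian := isHermitian_fermionPartialTrace _ hρ
  -- transport along the bijection `shiftEmb v Λ : Λ ≃ Λ + v`
  rw [← fermionPartialTrace_refl (fermionPartialTrace (PolySite.toTorusEmb L h') ρ),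
    ← vonNeumannEntropy_fermionPartialTrace_eq_of_range_eq (PolySite.shiftEmb v Λ) (Function.Embedding.refl _)
      (range_shiftEmb v Λ) hH',
    ← fermionPartialTrace_trans, shiftEmb_trans_toTorusEmb L v h h', fermionPartialTrace_trans,
    fermionPartialTrace_equiv]
  -- translation invariance: `Γ(τ_w)⁻¹ ρ = ρ`
  have hρw : (relabel (Orb.mapEquiv (FermionTorus.ofTorusEquiv (Equiv.addRight (Torus.proj L v))))).symm ρ = ρ := by
    rw [AlgEquiv.symm_apply_eq]
    exact (hTI (Torus.proj L v)).symm
  rw [hρw]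

/-! ### §3. The Markov bound on the entropy of an even translation-invariant torus state -/

omit [NeZero L] in
/-- Translates of a region inside `[0,ℓ)^d` by `v ∈ [0, L+1−ℓ)^d` stay inside `[0,L)^d`. [folklore] -/
private theorem shiftSet_subset_halfOpenBox {Λ : Finset (Site d)} {ℓ : ℕ} (hΛ : Λ ⊆ halfOpenBox d ℓ)
    (hℓL : ℓ ≤ L) {v : Site d} (hv : v ∈ halfOpenBox d (L + 1 - ℓ)) : shiftSet v Λ ⊆ halfOpenBox d L := by
  intro y hy
  rw [mem_shiftSet] at hy
  have h1 := mem_halfOpenBox.1 (hΛ hy)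
  have h2 := mem_halfOpenBox.1 hv
  rw [mem_halfOpenBox]
  intro i
  have a := h1 i
  have b := h2 i
  simp only [Pi.sub_apply] at a
  constructor <;> omega

/-- **Markov bound on the entropy of an even translation-invariant torus state.** For an even,
translation-invariant density matrix `ρ` on the fermionic torus of side `L`, a window `Λ ⊆ [0,ℓ)^d`
(`ℓ ≤ L`) with lexicographically largest site `a`:
`S(ρ) ≤ (L+1−ℓ)^d · (S(ρ_Λ) − S(ρ_{Λ∖a})) + (L^d − (L+1−ℓ)^d) · log 4`.
[cite: PoulinHastings2011, eqs. (3)–(6)] [cite: ArakiMoriya2003, Theorem 3.8 and §10] -/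
theorem torus_vonNeumannEntropy_le_window
    {ρ : Matrix (Finset (Orb (FermionTorus d L))) (Finset (Orb (FermionTorus d L))) ℂ}
    (hρ : ρ.PosSemidef) (htr : ρ.trace = 1) (hev : parityAut ρ = ρ)
    (hTI : ∀ w : TorusSite d L, relabel (Orb.translate w) ρ = ρ)
    {Λ : Finset (Site d)} {a : Site d} (ha : a ∈ Λ) (hmax : ∀ y ∈ Λ, toLex y ≤ toLex a)
    {ℓ : ℕ} (hΛ : Λ ⊆ halfOpenBox d ℓ) (hℓL : ℓ ≤ L) :
    vonNeumannEntropy ρ ≤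
      (((L + 1 - ℓ) ^ d : ℕ) : ℝ) *
          (vonNeumannEntropy (fermionPartialTrace (PolySite.toTorusEmb L (injOn_proj_of_subset_halfOpenBox' hΛ hℓL)) ρ) -
            vonNeumannEntropy (fermionPartialTrace
              (PolySite.toTorusEmb L (injOn_proj_of_subset_halfOpenBox' ((Λ.erase_subset a).trans hΛ) hℓL)) ρ)) +
        (((L ^ d : ℕ) : ℝ) - (((L + 1 - ℓ) ^ d : ℕ) : ℝ)) * Real.log 4 := by
  set ρ' : FermionOp (halfOpenBox d L) := fermionPartialTrace (torusBoxEmb L) ρ with hρ'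
  have hρ'psd : ρ'.PosSemidef := posSemidef_fermionPartialTrace _ hρ
  have hρ'tr : ρ'.trace = 1 := by rw [hρ', trace_fermionPartialTrace, htr]
  have hρ'ev : parityAut ρ' = ρ' := parityAut_fermionPartialTrace_of_even _ hev
  have hV : ∀ v ∈ halfOpenBox d (L + 1 - ℓ), shiftSet v Λ ⊆ halfOpenBox d L :=
    fun v hv => shiftSet_subset_halfOpenBox L hΛ hℓL hv
  -- the window entropies of the pull-back are those of `ρ`, and do not depend on the translate
  have hregion : ∀ {Λ₀ : Finset (Site d)} (h₀ : Λ₀ ⊆ halfOpenBox d ℓ) {v : Site d}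
      (hv : shiftSet v Λ₀ ⊆ halfOpenBox d L),
      regionEntropy ρ' (shiftSet v Λ₀) =
        vonNeumannEntropy (fermionPartialTrace (PolySite.toTorusEmb L (injOn_proj_of_subset_halfOpenBox' h₀ hℓL)) ρ) := by
    intro Λ₀ h₀ v hv
    rw [regionEntropy_of_subset ρ' hv, hρ', ← fermionPartialTrace_trans, incl_trans_torusBoxEmb L hv]
    exact vonNeumannEntropy_fermionPartialTrace_toTorusEmb_shiftSet L hρ.1 hTI v _ _
  have key := vonNeumannEntropy_le_of_window_entropies ha hmax (halfOpenBox d (L + 1 - ℓ)) hV hρ'psd hρ'tr hρ'ev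
    (fun v hv => hregion hΛ (hV v hv))
    (fun v hv => hregion ((Λ.erase_subset a).trans hΛ)
      ((fun y hy => hV v hv (by rw [mem_shiftSet] at hy ⊢; exact Finset.mem_of_mem_erase hy))))
  rw [card_halfOpenBox, card_halfOpenBox, hρ', vonNeumannEntropy_fermionPartialTrace_torusBoxEmb L hρ.1] at key
  exact key

/-! ### §4. The Gibbs density of an even translation-invariant Hamiltonian; the pressure bound -/

section Gibbs

variable {K : Matrix (Finset (Orb (FermionTorus d L))) (Finset (Orb (FermionTorus d L))) ℂ}

omit [NeZero L] in
/-- `P² = 1` for the fermion parity. [folklore] -/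
private theorem parityOp_mul_parityOp_torus :
    (parityOp : Matrix (Finset (Orb (FermionTorus d L))) (Finset (Orb (FermionTorus d L))) ℂ) * parityOp = 1 := by
  rw [parityOp, Matrix.diagonal_mul_diagonal, ← Matrix.diagonal_one]
  congr 1
  funext s
  rw [← mul_pow]
  norm_num

omit [NeZero L] in
/-- **The Gibbs density of an even Hamiltonian is even**: `Θ(e^{−βK}/Z) = e^{−βK}/Z` (`K` commutes
with the parity, hence so does `e^{−βK}`). [cite: ArakiMoriya2003, §4.1 Def. 4.5] -/
theorem parityAut_gibbsDensity (hKev : parityAut K = K) (β : ℝ) :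
    parityAut ((partitionFn β K)⁻¹ • gibbsWeight β K) = (partitionFn β K)⁻¹ • gibbsWeight β K := by
  have hPKP : parityOp * K * parityOp = K := by rw [← parityAut_apply]; exact hKev
  have hPK : Commute parityOp K := by
    change parityOp * K = K * parityOp
    conv_rhs => rw [← hPKP]
    rw [Matrix.mul_assoc (parityOp * K) parityOp parityOp, parityOp_mul_parityOp_torus, Matrix.mul_one]
  have hPW : Commute parityOp (gibbsWeight β K) := by
    rw [gibbsWeight]
    exact (hPK.smul_right (-(β : ℂ))).exp_right
  rw [map_smul, parityAut_apply, hPW.eq, Matrix.mul_assoc, parityOp_mul_parityOp_torus, Matrix.mul_one]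

/-- **The Gibbs density of a translation-invariant Hamiltonian is translation invariant.**
[cite: ArakiMoriya2003, §4.1 Def. 4.5] -/
theorem relabel_translate_gibbsDensity (hKTI : ∀ w : TorusSite d L, relabel (Orb.translate w) K = K) (β : ℝ)
    (w : TorusSite d L) :
    relabel (Orb.translate w) ((partitionFn β K)⁻¹ • gibbsWeight β K) = (partitionFn β K)⁻¹ • gibbsWeight β K := by
  rw [relabel_smul, ← gibbsWeight_relabel, hKTI w]

/-- **Markov bound on the pressure (finite torus).** For an even, translation-invariant Hermitian `K`
on the fermionic torus of side `L`, a real `β`, and a window `Λ ⊆ [0,ℓ)^d` (`ℓ ≤ L`) with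
lexicographically largest site `a`:
`log Z_β(K) ≤ (L+1−ℓ)^d · (S(ρ_Λ) − S(ρ_{Λ∖a})) + (L^d − (L+1−ℓ)^d) · log 4 − β · Re tr(ρ_β K)`,
`ρ_β = e^{−βK}/Z_β(K)` the Gibbs density and `ρ_Λ, ρ_{Λ∖a}` its window marginals. Gibbs variational
identity + `torus_vonNeumannEntropy_le_window`. [cite: PoulinHastings2011, eqs. (3)–(8)] -/
theorem torus_log_partitionFn_le_window (hK : K.IsHermitian) (hKev : parityAut K = K)
    (hKTI : ∀ w : TorusSite d L, relabel (Orb.translate w) K = K) (β : ℝ)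
    {Λ : Finset (Site d)} {a : Site d} (ha : a ∈ Λ) (hmax : ∀ y ∈ Λ, toLex y ≤ toLex a)
    {ℓ : ℕ} (hΛ : Λ ⊆ halfOpenBox d ℓ) (hℓL : ℓ ≤ L) :
    Real.log (partitionFn β K).re ≤
      (((L + 1 - ℓ) ^ d : ℕ) : ℝ) *
          (vonNeumannEntropy (fermionPartialTrace (PolySite.toTorusEmb L (injOn_proj_of_subset_halfOpenBox' hΛ hℓL))
              ((partitionFn β K)⁻¹ • gibbsWeight β K)) -
            vonNeumannEntropy (fermionPartialTrace
              (PolySite.toTorusEmb L (injOn_proj_of_subset_halfOpenBox' ((Λ.erase_subset a).trans hΛ) hℓL))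
              ((partitionFn β K)⁻¹ • gibbsWeight β K))) +
        (((L ^ d : ℕ) : ℝ) - (((L + 1 - ℓ) ^ d : ℕ) : ℝ)) * Real.log 4 -
        β * (((partitionFn β K)⁻¹ • gibbsWeight β K) * K).trace.re := by
  haveI : Nonempty (Finset (Orb (FermionTorus d L))) := ⟨∅⟩
  have hZ : partitionFn β K ≠ 0 := (partitionFn_pos β hK).ne'
  have hρ : ((partitionFn β K)⁻¹ • gibbsWeight β K).PosSemidef := hK.posSemidef_gibbsDensity β
  have htr : ((partitionFn β K)⁻¹ • gibbsWeight β K).trace = 1 := trace_gibbsDensity β K hZ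
  have hS := torus_vonNeumannEntropy_le_window L hρ htr (parityAut_gibbsDensity L hKev β)
    (relabel_translate_gibbsDensity L hKTI β) ha hmax hΛ hℓL
  -- Gibbs variational identity `S(ρ_β) = log Z + β ⟨K⟩_β`
  have hvar : vonNeumannEntropy ((partitionFn β K)⁻¹ • gibbsWeight β K) =
      Real.log (partitionFn β K).re + β * (((partitionFn β K)⁻¹ • gibbsWeight β K) * K).trace.re := by
    rw [hK.vonNeumannEntropy_gibbsDensity β, gibbsEntropy_def, trace_gibbsDensity_mul]
  linarith

/-- **The certified upper bound on the pressure** (Markov entropy bound + dual certificate). In the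
setting of `torus_log_partitionFn_le_window`, let `h ∈ 𝔄_Λ` be a Hermitian local energy representative
of `K` in the Gibbs state — `Re tr(ρ_β K) = L^d · Re tr(ρ_Λ h)` (`hKh`; e.g. the translation sum of
`h` is `K`) — and let `(L_B, c)` be a dual certificate for `H = β h` on the window:
`e^c · exp(L_B) − tr_{Λ→Λ∖a} exp(−β h + Γ L_B) ⪰ 0`. Then
`log Z_β(K) ≤ L^d · c + (L^d − (L+1−ℓ)^d) · (log 4 − c − β · e)` with `e = Re tr(ρ_Λ h)` the energy per
site: the pressure is at most `c` up to a boundary term `O(ℓ/L)`. [cite: PoulinHastings2011, eqs. (3)–(8)] -/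
theorem torus_log_partitionFn_le_of_certificate (hK : K.IsHermitian) (hKev : parityAut K = K)
    (hKTI : ∀ w : TorusSite d L, relabel (Orb.translate w) K = K) (β : ℝ)
    {Λ : Finset (Site d)} {a : Site d} (ha : a ∈ Λ) (hmax : ∀ y ∈ Λ, toLex y ≤ toLex a)
    {ℓ : ℕ} (hΛ : Λ ⊆ halfOpenBox d ℓ) (hℓL : ℓ ≤ L)
    {h : FermionOp Λ} (hh : h.IsHermitian)
    (hKh : (((partitionFn β K)⁻¹ • gibbsWeight β K) * K).trace.re =
      ((L : ℝ) ^ d) * (fermionPartialTrace (PolySite.toTorusEmb L (injOn_proj_of_subset_halfOpenBox' hΛ hℓL))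
        ((partitionFn β K)⁻¹ • gibbsWeight β K) * h).trace.re)
    {LB : FermionOp (Λ.erase a)} (hLB : LB.IsHermitian) {c : ℝ}
    (hcert : ((Real.exp c : ℂ) • cfc Real.exp LB -
      fermionPartialTrace (PolySite.incl (Finset.erase_subset a Λ))
        (cfc Real.exp (-((β : ℂ) • h) + fermionEmbed (PolySite.incl (Finset.erase_subset a Λ)) LB))).PosSemidef) :
    Real.log (partitionFn β K).re ≤
      ((L : ℝ) ^ d) * c +
        (((L ^ d : ℕ) : ℝ) - (((L + 1 - ℓ) ^ d : ℕ) : ℝ)) *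
          (Real.log 4 - c - β *
            (fermionPartialTrace (PolySite.toTorusEmb L (injOn_proj_of_subset_halfOpenBox' hΛ hℓL))
              ((partitionFn β K)⁻¹ • gibbsWeight β K) * h).trace.re) := by
  haveI : Nonempty (Finset (Orb (FermionTorus d L))) := ⟨∅⟩
  have hZ : partitionFn β K ≠ 0 := (partitionFn_pos β hK).ne'
  set ρ := (partitionFn β K)⁻¹ • gibbsWeight β K with hρdef
  have hρ : ρ.PosSemidef := hK.posSemidef_gibbsDensity β
  have htr : ρ.trace = 1 := trace_gibbsDensity β K hZ
  set ιΛ := PolySite.toTorusEmb L (injOn_proj_of_subset_halfOpenBox' hΛ hℓL) with hιΛ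
  set σ : FermionOp Λ := fermionPartialTrace ιΛ ρ with hσ
  have hσpsd : σ.PosSemidef := posSemidef_fermionPartialTrace _ hρ
  have hσtr : σ.trace = 1 := by rw [hσ, trace_fermionPartialTrace, htr]
  have hH : ((β : ℂ) • h).IsHermitian := by
    change ((β : ℂ) • h)ᴴ = (β : ℂ) • h
    rw [Matrix.conjTranspose_smul, Complex.star_def, Complex.conj_ofReal, hh.eq]
  -- the certificate on the window
  have hcertineq := fermion_condFreeEnergy_le_of_certificate ha hmax hσpsd hσtr hH hLB hcert
  -- the shield marginal of the window marginal is the shield marginal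
  have hB : fermionPartialTrace (PolySite.incl (Finset.erase_subset a Λ)) σ =
      fermionPartialTrace (PolySite.toTorusEmb L
        (injOn_proj_of_subset_halfOpenBox' ((Λ.erase_subset a).trans hΛ) hℓL)) ρ := by
    rw [hσ, ← fermionPartialTrace_trans]
    rfl
  have htrβ : (σ * ((β : ℂ) • h)).trace.re = β * (σ * h).trace.re := by
    rw [Matrix.mul_smul, Matrix.trace_smul, smul_eq_mul, Complex.re_ofReal_mul]
  rw [hB, htrβ] at hcertineq
  have hwin := torus_log_partitionFn_le_window L hK hKev hKTI β ha hmax hΛ hℓL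
  rw [← hρdef, ← hιΛ, ← hσ, hKh] at hwin
  -- bookkeeping: `N ≤ L^d`
  have hLd : ((L ^ d : ℕ) : ℝ) = (L : ℝ) ^ d := by push_cast; ring
  have hNnat : (L + 1 - ℓ) ^ d ≤ L ^ d := by
    rcases Nat.eq_zero_or_pos ℓ with hℓ | hℓ
    · rcases Nat.eq_zero_or_pos d with hd | hd
      · subst hd; simp
      · exfalso
        have := mem_halfOpenBox.1 (hΛ ha) ⟨0, hd⟩
        omega
    · exact Nat.pow_le_pow_left (by omega) d
  have hN : (((L + 1 - ℓ) ^ d : ℕ) : ℝ) ≤ (L : ℝ) ^ d := by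
    rw [← hLd]
    exact_mod_cast hNnat
  have hN0 : (0 : ℝ) ≤ (((L + 1 - ℓ) ^ d : ℕ) : ℝ) := by positivity
  have h1 : (((L + 1 - ℓ) ^ d : ℕ) : ℝ) * (vonNeumannEntropy σ -
      vonNeumannEntropy (fermionPartialTrace (PolySite.toTorusEmb L
        (injOn_proj_of_subset_halfOpenBox' ((Λ.erase_subset a).trans hΛ) hℓL)) ρ)) ≤
      (((L + 1 - ℓ) ^ d : ℕ) : ℝ) * (c + β * (σ * h).trace.re) :=
    mul_le_mul_of_nonneg_left (by linarith) hN0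
  rw [hLd] at hwin ⊢
  nlinarith [hwin, h1, hN, hN0]

end Gibbs

end Literature.MathematicalPhysics.QuantumLattice

end
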